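import Mathlib
import Summits.Ventures.PercRepro2.Defs
import Summits.Ventures.PercRepro2.Graph
import Summits.Ventures.PercRepro2.Events
import Summits.Ventures.PercRepro2.Induced
import Summits.Ventures.PercRepro2.Frontier
import Summits.Ventures.PercRepro2.BHKEvents
import Summits.Ventures.PercRepro2.BTVFamilyDefs

/-!
# The block family: contracted connectivity (blind cell PercRepro2, mine-1 g53;
paper proofs/MINE1-BLOCKS.md §1, §2.3 (F3))

A BLOCK STRUCTURE is a finite family `𝒰` of vertex sets; `x ↔_𝒰 y` (`ConnB`) is the
reflexive-transitive closure of «connected in the configuration, or both in one block of `𝒰`» —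
connectivity with every block contracted to a point, the `S`-condition «every block is reached
by `s`» of the cells `b`, `j` of the block family (several `u`'s, each attached to its block).

Lemmas: monotonicity in the configuration and under coarsening of the blocks; the REVEAL LEMMA
at a block vertex `z` (`connB_reveal`, `forall_connSetB_reveal_iff`): for `x, y ≠ z`, `x ↔_𝒰 y`
in `G[U]` iff `x ↔_{𝒰 ▹ ξ} y` in `G[U ∖ z]`, where `𝒰 ▹ ξ` (`revealBlocks`) keeps the blocks
not containing `z` and merges the blocks through `z` into one block with `z` replaced by its open
neighbours. The transfer lemmas (an avoided vertex; the fibre of an explored cluster) are in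
`BlockFamilyDefs.lean`.
-/

namespace Summit.Ventures.PercRepro2

namespace BlockFamily

open BTVFamily

/-! ## Contracted connectivity -/

section ConnB

variable {V : Type*} {E : Type*}

/-- One step of the contracted connectivity: a connection of `ω`, or two vertices of one block. -/
def BStep (ends : E → Sym2 V) (ω : Config E) (𝒰 : Finset (Finset V)) (x y : V) : Prop :=
  Conn ends ω x y ∨ ∃ B ∈ 𝒰, x ∈ B ∧ y ∈ B

/-- Contracted connectivity `x ↔_𝒰 y`: connectivity with every block of `𝒰` contracted. -/
def ConnB (ends : E → Sym2 V) (ω : Config E) (𝒰 : Finset (Finset V)) (x y : V) : Prop :=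
  Relation.ReflTransGen (BStep ends ω 𝒰) x y

/-- `X ↔_𝒰 Y`: some vertex of `X` is contracted-connected to some vertex of `Y`. -/
def ConnSetB (ends : E → Sym2 V) (ω : Config E) (𝒰 : Finset (Finset V)) (X Y : Finset V) :
    Prop :=
  ∃ x ∈ X, ∃ y ∈ Y, ConnB ends ω 𝒰 x y

variable {ends : E → Sym2 V} {ω : Config E} {𝒰 : Finset (Finset V)}

/-- A step is symmetric. -/
lemma bStep_symm {x y : V} (h : BStep ends ω 𝒰 x y) : BStep ends ω 𝒰 y x := by
  rcases h with h | ⟨B, hB, hx, hy⟩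
  · exact Or.inl (conn_symm h)
  · exact Or.inr ⟨B, hB, hy, hx⟩

/-- `x ↔_𝒰 x`. -/
lemma connB_refl (x : V) : ConnB ends ω 𝒰 x x := Relation.ReflTransGen.refl

/-- **Induction on a contracted connection**, with the step relation exposed. -/
lemma connB_induction {x : V} {P : V → Prop} (h0 : P x)
    (hstep : ∀ b y, ConnB ends ω 𝒰 x b → P b → BStep ends ω 𝒰 b y → P y) {y : V}
    (h : ConnB ends ω 𝒰 x y) : P y := by
  induction h with
  | refl => exact h0
  | tail hxb hby ih => exact hstep _ _ hxb ih hby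

/-- `x ↔_𝒰 y` is symmetric. -/
lemma connB_symm {x y : V} (h : ConnB ends ω 𝒰 x y) : ConnB ends ω 𝒰 y x := by
  induction h with
  | refl => exact Relation.ReflTransGen.refl
  | tail _ hby ih => exact Relation.ReflTransGen.trans (Relation.ReflTransGen.single (bStep_symm hby)) ih

/-- `x ↔_𝒰 y` is transitive. -/
lemma connB_trans {x y w : V} (h₁ : ConnB ends ω 𝒰 x y) (h₂ : ConnB ends ω 𝒰 y w) :
    ConnB ends ω 𝒰 x w :=
  Relation.ReflTransGen.trans h₁ h₂

/-- A connection is a contracted connection. -/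
lemma connB_of_conn {x y : V} (h : Conn ends ω x y) : ConnB ends ω 𝒰 x y :=
  Relation.ReflTransGen.single (Or.inl h)

/-- Two vertices of one block are contracted-connected. -/
lemma connB_of_mem_block {B : Finset V} (hB : B ∈ 𝒰) {x y : V} (hx : x ∈ B) (hy : y ∈ B) :
    ConnB ends ω 𝒰 x y :=
  Relation.ReflTransGen.single (Or.inr ⟨B, hB, hx, hy⟩)

/-- Contracted connectivity is monotone in the configuration. -/
lemma connB_mono_config {ω' : Config E} (h : ω ≤ ω') {x y : V} (hc : ConnB ends ω 𝒰 x y) :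
    ConnB ends ω' 𝒰 x y := by
  refine connB_induction (P := fun y => ConnB ends ω' 𝒰 x y) (connB_refl x)
    (fun b y _ hb hby => connB_trans hb (Relation.ReflTransGen.single ?_)) hc
  rcases hby with hby | hby
  · exact Or.inl (conn_mono h hby)
  · exact Or.inr hby

/-- Contracted connectivity is monotone under coarsening the blocks: if every block of `𝒰` lies
in a block of `𝒰'`, then `x ↔_𝒰 y` implies `x ↔_𝒰' y`. -/
lemma connB_mono_blocks {𝒰' : Finset (Finset V)} (h : ∀ B ∈ 𝒰, ∃ B' ∈ 𝒰', B ⊆ B') {x y : V}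
    (hc : ConnB ends ω 𝒰 x y) : ConnB ends ω 𝒰' x y := by
  refine connB_induction (P := fun y => ConnB ends ω 𝒰' x y) (connB_refl x)
    (fun b y _ hb hby => connB_trans hb (Relation.ReflTransGen.single ?_)) hc
  rcases hby with hby | ⟨B, hB, ha, hb⟩
  · exact Or.inl hby
  · obtain ⟨B', hB', hBB'⟩ := h B hB
    exact Or.inr ⟨B', hB', hBB' ha, hBB' hb⟩

/-- `X ↔_𝒰 Y` is monotone in the configuration. -/
lemma connSetB_mono_config {ω' : Config E} (h : ω ≤ ω') {X Y : Finset V}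
    (hc : ConnSetB ends ω 𝒰 X Y) : ConnSetB ends ω' 𝒰 X Y := by
  obtain ⟨x, hx, y, hy, hxy⟩ := hc
  exact ⟨x, hx, y, hy, connB_mono_config h hxy⟩

/-- `X ↔_𝒰 Y` is monotone under coarsening the blocks. -/
lemma connSetB_mono_blocks {𝒰' : Finset (Finset V)} (h : ∀ B ∈ 𝒰, ∃ B' ∈ 𝒰', B ⊆ B')
    {X Y : Finset V} (hc : ConnSetB ends ω 𝒰 X Y) : ConnSetB ends ω 𝒰' X Y := by
  obtain ⟨x, hx, y, hy, hxy⟩ := hc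
  exact ⟨x, hx, y, hy, connB_mono_blocks h hxy⟩

/-- `X ↔_𝒰 Y` is monotone in `Y`. -/
lemma connSetB_mono_right {X Y Y' : Finset V} (h : Y ⊆ Y') (hc : ConnSetB ends ω 𝒰 X Y) :
    ConnSetB ends ω 𝒰 X Y' := by
  obtain ⟨x, hx, y, hy, hxy⟩ := hc
  exact ⟨x, hx, y, h hy, hxy⟩

/-- `{x} ↔_𝒰 Y` iff `x` is contracted-connected to some vertex of `Y`. -/
lemma connSetB_singleton_left {x : V} {Y : Finset V} :
    ConnSetB ends ω 𝒰 {x} Y ↔ ∃ y ∈ Y, ConnB ends ω 𝒰 x y := by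
  constructor
  · rintro ⟨x', hx', y, hy, h⟩
    rw [Finset.mem_singleton] at hx'
    subst hx'
    exact ⟨y, hy, h⟩
  · rintro ⟨y, hy, h⟩
    exact ⟨x, Finset.mem_singleton_self x, y, hy, h⟩

/-- A plain connection from a vertex of a block makes the whole block contracted-connected. -/
lemma connB_of_conn_of_mem_block {B : Finset V} (hB : B ∈ 𝒰) {x b y : V} (hb : b ∈ B)
    (hy : y ∈ B) (h : Conn ends ω x b) : ConnB ends ω 𝒰 x y :=
  connB_trans (connB_of_conn h) (connB_of_mem_block hB hb hy)

end ConnB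

/-! ## Revealing a block vertex -/

section Reveal

variable {V : Type*} {E : Type*} [Fintype E] [DecidableEq V] {ends : E → Sym2 V} {U : Finset V}
  {z : V} {ω : Config E}

/-- The blocks after revealing `z`: the blocks not containing `z`, together with the union of
the blocks containing `z`, `z` removed and the revealed set `F` added. -/
def revealBlocks (𝒰 : Finset (Finset V)) (z : V) (F : Finset V) : Finset (Finset V) :=
  𝒰.filter (fun B => z ∉ B) ∪ {((𝒰.filter (fun B => z ∈ B)).biUnion id).erase z ∪ F}

/-- The merged block of `revealBlocks`. -/
def mergedBlock (𝒰 : Finset (Finset V)) (z : V) (F : Finset V) : Finset V :=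
  ((𝒰.filter (fun B => z ∈ B)).biUnion id).erase z ∪ F

omit [Fintype E] in
/-- The merged block is a block of the revealed structure. -/
lemma mergedBlock_mem_revealBlocks (𝒰 : Finset (Finset V)) (z : V) (F : Finset V) :
    mergedBlock 𝒰 z F ∈ revealBlocks 𝒰 z F :=
  Finset.mem_union_right _ (Finset.mem_singleton_self _)

omit [Fintype E] in
/-- A block not containing `z` is a block of the revealed structure. -/
lemma mem_revealBlocks_of_not_mem {𝒰 : Finset (Finset V)} {B : Finset V} (hB : B ∈ 𝒰)
    (hz : z ∉ B) (F : Finset V) : B ∈ revealBlocks 𝒰 z F :=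
  Finset.mem_union_left _ (Finset.mem_filter.2 ⟨hB, hz⟩)

omit [Fintype E] in
/-- The revealed set lies in the merged block. -/
lemma subset_mergedBlock_right (𝒰 : Finset (Finset V)) (z : V) (F : Finset V) :
    F ⊆ mergedBlock 𝒰 z F :=
  Finset.subset_union_right

omit [Fintype E] in
/-- A block through `z`, minus `z`, lies in the merged block. -/
lemma erase_subset_mergedBlock {𝒰 : Finset (Finset V)} {B : Finset V} (hB : B ∈ 𝒰) (hz : z ∈ B)
    (F : Finset V) : B.erase z ⊆ mergedBlock 𝒰 z F := by
  intro x hx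
  refine Finset.mem_union_left _ ?_
  rw [Finset.mem_erase] at hx ⊢
  exact ⟨hx.1, Finset.mem_biUnion.2 ⟨B, Finset.mem_filter.2 ⟨hB, hz⟩, hx.2⟩⟩

omit [Fintype E] in
/-- Membership in the revealed structure. -/
lemma mem_revealBlocks {𝒰 : Finset (Finset V)} {F B : Finset V} :
    B ∈ revealBlocks 𝒰 z F ↔ (B ∈ 𝒰 ∧ z ∉ B) ∨ B = mergedBlock 𝒰 z F := by
  simp only [revealBlocks, Finset.mem_union, Finset.mem_filter, Finset.mem_singleton, mergedBlock]

omit [Fintype E] in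
/-- Every block of a revealed structure lies in a block of the structure revealed with a larger
set. -/
lemma revealBlocks_mono {𝒰 : Finset (Finset V)} {F F' : Finset V} (h : F ⊆ F') :
    ∀ B ∈ revealBlocks 𝒰 z F, ∃ B' ∈ revealBlocks 𝒰 z F', B ⊆ B' := by
  intro B hB
  rcases mem_revealBlocks.1 hB with ⟨hB, hz⟩ | rfl
  · exact ⟨B, mem_revealBlocks_of_not_mem hB hz F', le_rfl⟩
  · exact ⟨_, mergedBlock_mem_revealBlocks 𝒰 z F', Finset.union_subset_union_right h⟩

variable (hzU : z ∈ U) {𝒰 : Finset (Finset V)}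
include hzU

/-- A vertex of the merged block is contracted-connected to `z` in `G[U]`. -/
lemma connB_z_of_mem_mergedBlock {m : V} (hm : m ∈ mergedBlock 𝒰 z (frontier ends U {z} ω)) :
    ConnB ends (induced ends (↑U) ω) 𝒰 m z := by
  rcases Finset.mem_union.1 hm with hm | hm
  · rw [Finset.mem_erase, Finset.mem_biUnion] at hm
    obtain ⟨_, B, hB, hmB⟩ := hm
    rw [Finset.mem_filter] at hB
    exact connB_of_mem_block hB.1 hmB hB.2
  · exact connB_of_conn (conn_symm (conn_frontier_of_mem hzU hm))

/-- **Revealing `z`, the easy direction**: a contracted connection in `G[U ∖ z]` with the revealed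
blocks is a contracted connection in `G[U]`. -/
lemma connB_of_connB_reveal {x y : V}
    (h : ConnB ends (induced ends (↑(U \ {z})) ω) (revealBlocks 𝒰 z (frontier ends U {z} ω)) x y) :
    ConnB ends (induced ends (↑U) ω) 𝒰 x y := by
  refine connB_induction (P := fun y => ConnB ends (induced ends (↑U) ω) 𝒰 x y) (connB_refl x)
    (fun b y _ hb hby => connB_trans hb ?_) h
  rcases hby with hby | ⟨B, hB, hbB, hyB⟩
  · exact connB_of_conn (conn_of_conn_sdiff hby)
  · rcases mem_revealBlocks.1 hB with ⟨hB, _⟩ | rfl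
    · exact connB_of_mem_block hB hbB hyB
    · exact connB_trans (connB_z_of_mem_mergedBlock hzU hbB)
        (connB_symm (connB_z_of_mem_mergedBlock hzU hyB))

/-- **Revealing `z`, the hard direction**: for `x ≠ z`, a contracted connection `x ↔_𝒰 y` in
`G[U]` is a contracted connection with the revealed blocks in `G[U ∖ z]` when `y ≠ z`, and
reaches some vertex of the merged block when `y = z`. -/
lemma connB_reveal_aux {x : V} (hxz : x ≠ z) {y : V} (h : ConnB ends (induced ends (↑U) ω) 𝒰 x y) :
    (y ≠ z → ConnB ends (induced ends (↑(U \ {z})) ω) (revealBlocks 𝒰 z (frontier ends U {z} ω))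
        x y) ∧
      (y = z → ∃ m ∈ mergedBlock 𝒰 z (frontier ends U {z} ω),
        ConnB ends (induced ends (↑(U \ {z})) ω) (revealBlocks 𝒰 z (frontier ends U {z} ω)) x m) := by
  set F := frontier ends U {z} ω with hF
  set M := mergedBlock 𝒰 z F with hM
  set 𝒰' := revealBlocks 𝒰 z F with h𝒰'
  have hM' : M ∈ 𝒰' := mergedBlock_mem_revealBlocks 𝒰 z F
  refine connB_induction (P := fun y => (y ≠ z → ConnB ends (induced ends (↑(U \ {z})) ω) 𝒰' x y) ∧
    (y = z → ∃ m ∈ M, ConnB ends (induced ends (↑(U \ {z})) ω) 𝒰' x m))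
    ⟨fun _ => connB_refl x, fun h => absurd h hxz⟩ ?_ h
  rintro b y _ ⟨ih1, ih2⟩ hby
  by_cases hbz : b = z
  · -- `b = z`: the induction hypothesis gives a vertex `m` of the merged block
    subst hbz
    obtain ⟨m, hm, hxm⟩ := ih2 rfl
    refine ⟨fun hyz => ?_, fun _ => ⟨m, hm, hxm⟩⟩
    rcases hby with hby | ⟨B, hB, hbB, hyB⟩
    · obtain ⟨f, hf, hyf⟩ := (conn_z_iff hzU hyz).1 (conn_symm hby)
      exact connB_trans hxm (connB_trans (connB_of_mem_block hM' hm (subset_mergedBlock_right _ _ _ hf))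
        (connB_of_conn (conn_symm hyf)))
    · exact connB_trans hxm (connB_of_mem_block hM' hm
        (erase_subset_mergedBlock hB hbB F (Finset.mem_erase.2 ⟨hyz, hyB⟩)))
  · have hxb := ih1 hbz
    rcases hby with hby | ⟨B, hB, hbB, hyB⟩
    · -- a plain connection `b ↔ y` in `G[U]`
      refine ⟨fun hyz => ?_, fun hyz => ?_⟩
      · rcases conn_sdiff_or_conn_z (z := z) hby with h' | h'
        · exact connB_trans hxb (connB_of_conn h')
        · obtain ⟨f, hf, hbf⟩ := (conn_z_iff hzU hbz).1 h'
          obtain ⟨f', hf', hyf'⟩ := (conn_z_iff hzU hyz).1 (conn_trans (conn_symm hby) h')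
          exact connB_trans hxb (connB_trans (connB_of_conn hbf)
            (connB_trans (connB_of_mem_block hM' (subset_mergedBlock_right _ _ _ hf)
              (subset_mergedBlock_right _ _ _ hf')) (connB_of_conn (conn_symm hyf'))))
      · subst hyz
        obtain ⟨f, hf, hbf⟩ := (conn_z_iff hzU hbz).1 hby
        exact ⟨f, subset_mergedBlock_right _ _ _ hf, connB_trans hxb (connB_of_conn hbf)⟩
    · -- a block step `b, y ∈ B`
      refine ⟨fun hyz => ?_, fun hyz => ?_⟩
      · by_cases hzB : z ∈ B
        · exact connB_trans hxb (connB_of_mem_block hM'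
            (erase_subset_mergedBlock hB hzB F (Finset.mem_erase.2 ⟨hbz, hbB⟩))
            (erase_subset_mergedBlock hB hzB F (Finset.mem_erase.2 ⟨hyz, hyB⟩)))
        · exact connB_trans hxb (connB_of_mem_block (mem_revealBlocks_of_not_mem hB hzB F) hbB hyB)
      · subst hyz
        exact ⟨b, erase_subset_mergedBlock hB hyB F (Finset.mem_erase.2 ⟨hbz, hbB⟩), hxb⟩

/-- **The reveal lemma for contracted connectivity**: for `x, y ≠ z`, `x ↔_𝒰 y` in `G[U]` iff
`x ↔_{𝒰 ▹ ξ} y` in `G[U ∖ z]`. -/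
lemma connB_reveal {x y : V} (hxz : x ≠ z) (hyz : y ≠ z) :
    ConnB ends (induced ends (↑U) ω) 𝒰 x y ↔
      ConnB ends (induced ends (↑(U \ {z})) ω) (revealBlocks 𝒰 z (frontier ends U {z} ω)) x y :=
  ⟨fun h => (connB_reveal_aux hzU hxz h).1 hyz, connB_of_connB_reveal hzU⟩

/-- Reaching `z` in `G[U]` is reaching the merged block in `G[U ∖ z]`. -/
lemma connB_z_iff {x : V} (hxz : x ≠ z) :
    ConnB ends (induced ends (↑U) ω) 𝒰 x z ↔
      ∃ m ∈ mergedBlock 𝒰 z (frontier ends U {z} ω),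
        ConnB ends (induced ends (↑(U \ {z})) ω) (revealBlocks 𝒰 z (frontier ends U {z} ω)) x m := by
  constructor
  · exact fun h => (connB_reveal_aux hzU hxz h).2 rfl
  · rintro ⟨m, hm, hxm⟩
    exact connB_trans (connB_of_connB_reveal hzU hxm) (connB_z_of_mem_mergedBlock hzU hm)

/-- **Revealing `z` inside a block**: for `x ≠ z` and a block `B ∋ z`, `{x} ↔_𝒰 B` in `G[U]` iff
`{x} ↔_{𝒰 ▹ ξ} M` in `G[U ∖ z]`, `M` the merged block. -/
lemma connSetB_reveal_block {x : V} (hxz : x ≠ z) {B : Finset V} (hB : B ∈ 𝒰) (hzB : z ∈ B) :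
    ConnSetB ends (induced ends (↑U) ω) 𝒰 {x} B ↔
      ConnSetB ends (induced ends (↑(U \ {z})) ω) (revealBlocks 𝒰 z (frontier ends U {z} ω)) {x}
        (mergedBlock 𝒰 z (frontier ends U {z} ω)) := by
  rw [connSetB_singleton_left, connSetB_singleton_left]
  constructor
  · rintro ⟨b, hb, hxb⟩
    by_cases hbz : b = z
    · subst hbz
      exact (connB_z_iff hzU hxz).1 hxb
    · exact ⟨b, erase_subset_mergedBlock hB hzB _ (Finset.mem_erase.2 ⟨hbz, hb⟩),
        (connB_reveal hzU hxz hbz).1 hxb⟩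
  · rintro ⟨m, hm, hxm⟩
    exact ⟨z, hzB, (connB_z_iff hzU hxz).2 ⟨m, hm, hxm⟩⟩

/-- **Revealing `z` outside a block**: for `x ≠ z` and a block `B ∌ z`, `{x} ↔_𝒰 B` in `G[U]` iff
`{x} ↔_{𝒰 ▹ ξ} B` in `G[U ∖ z]`. -/
lemma connSetB_reveal_notMem {x : V} (hxz : x ≠ z) {B : Finset V} (hzB : z ∉ B) :
    ConnSetB ends (induced ends (↑U) ω) 𝒰 {x} B ↔
      ConnSetB ends (induced ends (↑(U \ {z})) ω) (revealBlocks 𝒰 z (frontier ends U {z} ω)) {x}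
        B := by
  rw [connSetB_singleton_left, connSetB_singleton_left]
  constructor
  · rintro ⟨b, hb, hxb⟩
    exact ⟨b, hb, (connB_reveal hzU hxz (fun h => hzB (h ▸ hb))).1 hxb⟩
  · rintro ⟨b, hb, hxb⟩
    exact ⟨b, hb, (connB_reveal hzU hxz (fun h => hzB (h ▸ hb))).2 hxb⟩

/-- **The `S`-condition is revealed blockwise**: when some block contains `z` and `x ≠ z`,
«every block is reached by `x`» in `G[U]` iff «every revealed block is reached by `x`» in
`G[U ∖ z]`. -/
lemma forall_connSetB_reveal_iff {x : V} (hxz : x ≠ z) (hz : ∃ B ∈ 𝒰, z ∈ B) :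
    (∀ B ∈ 𝒰, ConnSetB ends (induced ends (↑U) ω) 𝒰 {x} B) ↔
      ∀ B ∈ revealBlocks 𝒰 z (frontier ends U {z} ω),
        ConnSetB ends (induced ends (↑(U \ {z})) ω) (revealBlocks 𝒰 z (frontier ends U {z} ω))
          {x} B := by
  constructor
  · intro h B' hB'
    rcases mem_revealBlocks.1 hB' with ⟨hB', hzB'⟩ | rfl
    · exact (connSetB_reveal_notMem hzU hxz hzB').1 (h B' hB')
    · obtain ⟨B, hB, hzB⟩ := hz
      exact (connSetB_reveal_block hzU hxz hB hzB).1 (h B hB)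
  · intro h B hB
    by_cases hzB : z ∈ B
    · exact (connSetB_reveal_block hzU hxz hB hzB).2 (h _ (mergedBlock_mem_revealBlocks _ _ _))
    · exact (connSetB_reveal_notMem hzU hxz hzB).2 (h B (mem_revealBlocks_of_not_mem hB hzB _))

end Reveal

end BlockFamily

end Summit.Ventures.PercRepro2
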